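import Summits.QuantumFields.YangMills.Theorems.LuscherReductionTwistedTraceScalingToronOrbitSpectrum
import HarnessLib

/-!
# Averaging over the symmetries of `V_θ`: a linear functional on `LinkSpace L` invariant under lattice translations and the global `T₃`-rotation by `π`
# sees only the NEUTRAL DIRECTION-CONSTANT part of its argument
# (VALLEY term of S-BASE, crux `TwistedTraceScaling` stmt-QuantumFields-20203; design `pub/ym-fleet/ym-luscher-20007-p1/COARSE-DESIGN.md` §13 (γ2), (γ4)(i))

This is the symmetry half of the valley's perturbation theory: the first variation `ℓ = dΦ_{V_θ}` of any translation- and `T₃`-rotation-invariant spectral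
functional `Φ(U) = Σ f(aᵢ(U))` (both symmetries fix `V_θ`, `…ToronOrbitSpectrum` §4) satisfies the two hypotheses below, hence `dΦ_{V_θ}(x) = dΦ_{V_θ}(x̄₀)`
with `x̄₀ = neutralAvg x` the neutral, direction-constant (zero-momentum) part of `x` — a tangent vector ALONG the toron valley.  So the zero-point sum moves at
first order only along the valley coordinate (absorbed by the choice of `θ`), and at second order transversally.
* `siteAvg`, `neutralAvg`; `sum_shiftLink` (Σ_y τ_y x = |Λ|·siteAvg x); `rotLink_halfTurn_add` (R_π v + v = 2·(neutral part));
* ★★ `apply_eq_apply_neutralAvg` : `(∀ y x, ℓ(τ_y x) = ℓ x) → (∀ x, ℓ(R_π x) = ℓ x) → ℓ x = ℓ (neutralAvg x)`.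

HONEST FRAMING: finite group averaging at fixed `L`; femto rung R2b1 (brick for a stub of a child of a CONDITIONAL route); not a gap, not Clay.
-/

set_option autoImplicit false

noncomputable section

open Finset Module
open scoped BigOperators InnerProductSpace
open Literature.MathematicalPhysics.QuantumFieldTheory
open Literature.MathematicalPhysics.QuantumLattice

namespace Summit.QuantumFields.YangMills.Theorems.FemtoTransferGap.TwoLattice.Toron

open Summit.QuantumFields.YangMills.Theorems.FemtoTransferGap
open Summit.QuantumFields.YangMills.Theorems.FemtoTransferGap.TwoLattice
open Summit.QuantumFields.YangMills.Theorems.FemtoTransferGap.TwoLattice.Cov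
open Summit.QuantumFields.YangMills.Theorems.FemtoTransferGap.TwoLattice.Stiff

variable (L : ℕ) [NeZero L]

/-! ## §1 Site averages -/

/-- The site average of a link 1-form (its direction- and colour-wise constant, zero-momentum part): `(x̄)(·,i;a) = |Λ|⁻¹ Σ_z x(z,i;a)`. [folklore] -/
def siteAvg (x : LinkSpace L) : LinkSpace L :=
  WithLp.toLp 2 fun ea : Edge 3 L × Fin 3 => (Fintype.card (Site 3 L) : ℝ)⁻¹ * ∑ z : Site 3 L, x ((z, ea.1.2), ea.2)

/-- The NEUTRAL direction-constant part `(x̄₀)(·,i;a) = [a = 0]·|Λ|⁻¹ Σ_z x(z,i;0)` — a tangent vector along the toron valley. [cite: Luscher1983, §3] -/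
def neutralAvg (x : LinkSpace L) : LinkSpace L :=
  WithLp.toLp 2 fun ea : Edge 3 L × Fin 3 => if ea.2 = 0 then (Fintype.card (Site 3 L) : ℝ)⁻¹ * ∑ z : Site 3 L, x ((z, ea.1.2), 0) else 0

/-- Components. [folklore] -/
theorem siteAvg_apply (x : LinkSpace L) (e : Edge 3 L) (a : Fin 3) :
    siteAvg L x (e, a) = (Fintype.card (Site 3 L) : ℝ)⁻¹ * ∑ z : Site 3 L, x ((z, e.2), a) := rfl

/-- Components. [folklore] -/
theorem neutralAvg_apply (x : LinkSpace L) (e : Edge 3 L) (a : Fin 3) :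
    neutralAvg L x (e, a) = if a = 0 then (Fintype.card (Site 3 L) : ℝ)⁻¹ * ∑ z : Site 3 L, x ((z, e.2), 0) else 0 := rfl

/-- ★ Summing all translates gives `|Λ|` times the site average. [folklore] -/
theorem sum_shiftLink (x : LinkSpace L) : ∑ y : Site 3 L, shiftLink L y x = (Fintype.card (Site 3 L) : ℝ) • siteAvg L x := by
  ext ⟨e, a⟩
  rw [WithLp.ofLp_sum, Finset.sum_apply, WithLp.ofLp_smul, Pi.smul_apply, smul_eq_mul]
  change ∑ y : Site 3 L, shiftLink L y x (e, a) = (Fintype.card (Site 3 L) : ℝ) * siteAvg L x (e, a)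
  simp only [shiftLink_apply, siteAvg_apply]
  have hc : (Fintype.card (Site 3 L) : ℝ) ≠ 0 := by exact_mod_cast Fintype.card_ne_zero
  rw [← mul_assoc, mul_inv_cancel₀ hc, one_mul]
  exact Fintype.sum_equiv (Equiv.addLeft e.1) _ _ fun z => rfl

/-! ## §2 The half-turn about `T₃` -/

/-- `Ad(diagSU2(π/2)) = chargedRot π = diag(1, −1, −1)`: the half-turn flips the charged plane. [cite: BrockerTomDieck1985, I (1.10)] -/
theorem adRot_diagSU2_halfTurn_mulVec (v : Fin 3 → ℝ) : (adRot (diagSU2 (Real.pi / 2))).mulVec v = ![v 0, -v 1, -v 2] := by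
  rw [adRot_diagSU2, show 2 * (Real.pi / 2) = Real.pi by ring]
  ext a
  fin_cases a <;> simp [chargedRot, Matrix.mulVec, dotProduct, Fin.sum_univ_three, Real.cos_pi, Real.sin_pi]

omit [NeZero L] in
/-- ★ `R_π v + v = 2·(v₀, 0, 0)`: averaging over the half-turn projects onto the neutral colour. [folklore] -/
theorem rotLink_halfTurn_add_apply (v : LinkSpace L) (e : Edge 3 L) (a : Fin 3) :
    (rotLink (fun _ : Site 3 L => diagSU2 (Real.pi / 2)) v + v) (e, a) = if a = 0 then 2 * v (e, 0) else 0 := by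
  rw [PiLp.add_apply, rotLink_apply, adRot_diagSU2_halfTurn_mulVec]
  fin_cases a
  · simp; ring
  · simp
  · simp

/-- For the site average: `R_π x̄ + x̄ = 2·x̄₀`. [folklore] -/
theorem rotLink_halfTurn_siteAvg_add (x : LinkSpace L) :
    rotLink (fun _ : Site 3 L => diagSU2 (Real.pi / 2)) (siteAvg L x) + siteAvg L x = (2 : ℝ) • neutralAvg L x := by
  ext ⟨e, a⟩
  rw [WithLp.ofLp_smul, Pi.smul_apply, smul_eq_mul]
  change (rotLink (fun _ : Site 3 L => diagSU2 (Real.pi / 2)) (siteAvg L x) + siteAvg L x) (e, a) = 2 * neutralAvg L x (e, a)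
  rw [rotLink_halfTurn_add_apply, neutralAvg_apply, siteAvg_apply]
  split_ifs <;> simp

/-! ## §3 The averaging lemma -/

/-- ★★ **SYMMETRIC FUNCTIONALS SEE ONLY THE VALLEY DIRECTION**: a linear functional on `LinkSpace L` invariant under all lattice translations and under the
global half-turn about `T₃` satisfies `ℓ x = ℓ (neutralAvg x)`. [cite: Luscher1983, §3] -/
theorem apply_eq_apply_neutralAvg (ℓ : LinkSpace L →ₗ[ℝ] ℝ) (hT : ∀ (y : Site 3 L) (x : LinkSpace L), ℓ (shiftLink L y x) = ℓ x)
    (hR : ∀ x : LinkSpace L, ℓ (rotLink (fun _ : Site 3 L => diagSU2 (Real.pi / 2)) x) = ℓ x) (x : LinkSpace L) :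
    ℓ x = ℓ (neutralAvg L x) := by
  have hc : (Fintype.card (Site 3 L) : ℝ) ≠ 0 := by exact_mod_cast Fintype.card_ne_zero
  -- translations: `ℓ x = ℓ x̄`
  have h1 : ℓ x = ℓ (siteAvg L x) := by
    have h : (Fintype.card (Site 3 L) : ℝ) * ℓ x = (Fintype.card (Site 3 L) : ℝ) * ℓ (siteAvg L x) := by
      calc (Fintype.card (Site 3 L) : ℝ) * ℓ x = ∑ y : Site 3 L, ℓ (shiftLink L y x) := by
            simp only [hT, sum_const, card_univ, nsmul_eq_mul]
        _ = ℓ (∑ y : Site 3 L, shiftLink L y x) := (map_sum ℓ _ _).symm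
        _ = (Fintype.card (Site 3 L) : ℝ) * ℓ (siteAvg L x) := by rw [sum_shiftLink, map_smul, smul_eq_mul]
    exact mul_left_cancel₀ hc h
  -- half-turn: `ℓ x̄ = ℓ x̄₀`
  have h2 : 2 * ℓ (siteAvg L x) = 2 * ℓ (neutralAvg L x) := by
    calc 2 * ℓ (siteAvg L x) = ℓ (rotLink (fun _ : Site 3 L => diagSU2 (Real.pi / 2)) (siteAvg L x)) + ℓ (siteAvg L x) := by
          rw [hR, two_mul]
      _ = ℓ ((2 : ℝ) • neutralAvg L x) := by rw [← map_add, rotLink_halfTurn_siteAvg_add]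
      _ = 2 * ℓ (neutralAvg L x) := by rw [map_smul, smul_eq_mul]
  rw [h1]
  linarith

/-- The neutral average is itself translation invariant, direction-constant and neutral: `neutralAvg (neutralAvg x) = neutralAvg x`. [folklore] -/
theorem neutralAvg_neutralAvg (x : LinkSpace L) : neutralAvg L (neutralAvg L x) = neutralAvg L x := by
  have hc : (Fintype.card (Site 3 L) : ℝ) ≠ 0 := by exact_mod_cast Fintype.card_ne_zero
  ext ⟨e, a⟩
  change neutralAvg L (neutralAvg L x) (e, a) = neutralAvg L x (e, a)
  rw [neutralAvg_apply, neutralAvg_apply]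
  split_ifs with ha
  · simp only [neutralAvg_apply, if_true, sum_const, card_univ, nsmul_eq_mul]
    rw [← mul_assoc, inv_mul_cancel₀ hc, one_mul]
  · rfl

/-- `neutralAvg x` is a zero mode of the curl at every constant abelian background (it is a constant neutral 1-form: tangent to the flat valley).
[cite: Luscher1983, §3] -/
theorem covCurl_abelianCfg_neutralAvg (θ : Fin 3 → ℝ) (x : LinkSpace L) : covCurl (abelianCfg L θ) (neutralAvg L x) = 0 := by
  ext ⟨⟨y, kl⟩, a⟩
  rw [covCurl_abelianCfg_apply]
  obtain ⟨r00, r01, r02, r10, r20, -, -, -, -⟩ := chargedRot_entries (2 * θ kl.1.1)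
  obtain ⟨s00, s01, s02, s10, s20, -, -, -, -⟩ := chargedRot_entries (2 * θ kl.1.2)
  fin_cases a
  · simp [neutralAvg_apply, r00, s00]
  · simp [neutralAvg_apply, r10, s10]
  · simp [neutralAvg_apply, r20, s20]

end Summit.QuantumFields.YangMills.Theorems.FemtoTransferGap.TwoLattice.Toron

end
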